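import Summits.Ventures.YMGap.RobustBall.PlaquetteActionBridge
import Summits.Ventures.YMGap.RobustBall.RowsSU3Certified
import Summits.QuantumFields.BalabanUV.InfraRed.StrongCouplingPoincareDoorSUN
import HarnessLib

/-!
# Venture YMGap, track Y2 ROBUST-BALL — `SU(3)` PLAQUETTE-RUNG rows (headline row 4a, SU(3) column; SUB-BALL of
# plaquette-local members) through ds-4's robust star window on the cell's certified pair, every `d ≥ 2`

HONEST FRAMING.  Venture file of the cell `pub-ymgap` (QuantumFields programme), seat engine-2 (g6).  Strong-coupling LATTICE
statements only: `SU(3)` lattice Yang–Mills on the tori `(ℤ/L)^d`, `L ≥ 3` (uniform in `L`), Wilson's action at tree coupling `β_W/3`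
('t Hooft `β_W/9`) plus a PLAQUETTE-LOCAL member `W` — `IsPlaquetteAction f W`, ONE continuous class-function density `f` per plaquette
with oscillation `≤ a₀` and Frobenius-Lipschitz constant `≤ λ` (the SUB-BALL of rb-ref's T0.6; NOT the link ball of the headline rows);
conclusion = exponential clustering `ClustersWith W (β_W/3) A m` of the member's torus measure with explicit `(A, m)` depending on
`(d, c_eff)` only.  Nothing about `ℤ^d`/DLR, the continuum, weak coupling, or the Clay problem.  Kernel ARITHMETIC over ds-4's crux-Y2-X2
door `RobustBall.clustersWith_plaquetteAction` (star window of Lemma G for the generic class-function weight; any one-link modulus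
`OneLinkKRModulus N R K` by name; `c_eff = K e^{2(d−1)a₀}(1 + 2√N·2(d−1)λ)|β|/N + √N λ`, door `doorPoly d c_eff < 1`) fed with the cell's
CERTIFIED `SU(3)` pair P11 — H1 `OneLinkPoincareSUN 3 (3/5) (4/5)` (σ2 engines A+B, two partitions; class C) restricted to radius `11/30`, H2
`OneLinkVarianceBound 3 (11/30) (49/20)` (`pub-balaban` g17 + `ymgap` replay; class C-iv) — whose Cauchy–Schwarz modulus is `K = √(cv) = 7/5`
EXACTLY (`oneLinkKRModulus_of_poincare_of_varianceBound`).  NOTHING is asserted about H1/H2: every row is K-conditional on them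
(class «K × C(H1) × C-iv(H2)»), never K.

THE ROWS (density ball `osc f ≤ 2η`, `Lip_F f ≤ η`, the convention of row 4a; `η` at `1/1000`, rounded down; certificates in exact rational
arithmetic: `e^x ≤ T(x) = 1 + x + x²/2 + x³/6 + (5/96)x⁴` on `[0,1]`, `√3 ≤ 1.7321`, monotonicity of `doorPoly d` on `[0, ∞)`):
* `d = 4` (`c_eff = (7/45)e^{12η}(1 + 12√3 η)β_W + √3 η`, door `12c² + 10c < 1`, Wilson threshold `β_W = 0.580…`, radius cap `11/20`):
  `(β⋆_W, η) = (1/4, .015) (1/3, .010) (2/5, .007) (9/20, .004) (1/2, .002)` — rb-theory's `SU(2)` row 4a for comparison: `(1/5, .013) (1/4, .008) (3/10, .004)`;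
* `d = 3` (`c_eff = (28/135)e^{8η}(1 + 8√3 η)β_W + √3 η`, door `8c² + 6c < 1`): `(1/2, .017) (3/5, .011) (3/4, .005)`.
The density radii are small because the star door's `c⋆(4) = 0.0902` leaves little room above the Wilson part; this rung is reported as a
sub-ball entry, never as the headline ball (rb-ref T0.6).
-/

noncomputable section

open MeasureTheory ProbabilityTheory Real
open Literature.MathematicalPhysics.QuantumFieldTheory
open Literature.MathematicalPhysics.QuantumFieldTheory.Balaban1983to89.StrongCouplingDobrushinWindow (OneLinkKRModulus)
open Literature.MathematicalPhysics.QuantumFieldTheory.SUNBakryEmery (SUN)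
open Summit.QuantumFields.BalabanUV.InfraRed.StrongCouplingPoincareDoorSUN
  (OneLinkPoincareSUN OneLinkPoincareSUN.mono oneLinkKRModulus_of_poincare_of_varianceBound)
open Summit.QuantumFields.BalabanUV.InfraRed.StrongCouplingVarianceDoorSUN (OneLinkVarianceBound)
open Summit.Ventures.YMGap.StarResolventDim (gaugeR doorPoly)
open Summit.Ventures.YMGap.RobustBall (Perturbation IsPlaquetteAction ClustersWith clustersWith_plaquetteAction)

namespace Summit.Ventures.YMGap.RobustBallSU3

variable {d L : ℕ} [NeZero L]

/-! ### 1. The `SU(3)` plaquette rung on the certified pair, every `d ≥ 2` -/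

omit [NeZero L] in
/-- `doorPoly d` is monotone on `[0, ∞)` for `d ≥ 2`. [folklore] -/
theorem doorPoly_mono (hd : 2 ≤ d) {c c' : ℝ} (h0 : 0 ≤ c) (h : c ≤ c') : doorPoly d c ≤ doorPoly d c' := by
  unfold doorPoly
  have hd' : (2 : ℝ) ≤ d := by exact_mod_cast hd
  have h4 : (0 : ℝ) ≤ 4 * (d : ℝ) - 4 := by linarith
  have h6 : (0 : ℝ) ≤ 4 * (d : ℝ) - 6 := by linarith
  nlinarith [mul_le_mul h h h0 (h0.trans h), mul_nonneg h4 (sub_nonneg.2 (mul_le_mul h h h0 (h0.trans h))),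
    mul_nonneg h6 (sub_nonneg.2 h)]

/-- **`SU(3)`, every `d ≥ 2`: torus clustering for plaquette-local members through the robust star window on P11** (CONDITIONAL on
H1, H2).  For a continuous inversion-invariant class function `f` on `SU(3)` with `f x − f y ≤ a₀`, `|f x − f y| ≤ λ‖x − y‖_F`, a Wilson
coupling with `(d−1)|β_W| ≤ 33/20`, `c_eff = (7/5)e^{2(d−1)a₀}(1 + 2√3·2(d−1)λ)(|β_W|/9) + √3λ` and `doorPoly d c_eff < 1`: every
`W` with `IsPlaquetteAction f W` on a torus `L ≥ 3` clusters at tree coupling `β_W/3` with ds-4's constants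
`A = 4(2√3)² e^{2m}`, `m = (1 − ρ)²/(2(2ρ·2d + 1))`, `ρ = R_G^{(d)}(c_eff)`. [folklore] -/
theorem su3_clustersWith_plaquetteAction (hd : 2 ≤ d) (hL : 3 ≤ L) (hP : OneLinkPoincareSUN 3 (3 / 5) (4 / 5))
    (hV : OneLinkVarianceBound 3 (11 / 30) (49 / 20)) {βW a₀ lam : ℝ} (hlam : 0 ≤ lam)
    (hR : ((d : ℝ) - 1) * |βW| ≤ 33 / 20) {f : SUN 3 → ℝ} (hfc : Continuous f)
    (hfconj : ∀ g h : SUN 3, f (g * h * g⁻¹) = f h) (hfinv : ∀ h : SUN 3, f h⁻¹ = f h)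
    (hfosc : ∀ x y, f x - f y ≤ a₀) (hflip : ∀ x y, |f x - f y| ≤ lam * suFrobDist x y)
    {W : Perturbation d L 3} (hW : IsPlaquetteAction f W) {c : ℝ}
    (hc : c = 7 / 5 * exp (2 * ((d : ℝ) - 1) * a₀) * (1 + 2 * Real.sqrt 3 * (2 * ((d : ℝ) - 1) * lam)) * (|βW| / 9) +
      Real.sqrt 3 * lam)
    (hcd : doorPoly d c < 1) :
    ClustersWith W (βW / 3)
      (4 * (2 * Real.sqrt 3) ^ 2 * exp (2 * ((1 - gaugeR d c) ^ 2 / (2 * (2 * gaugeR d c * (2 * d : ℕ) + 1)))))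
      ((1 - gaugeR d c) ^ 2 / (2 * (2 * gaugeR d c * (2 * d : ℕ) + 1))) := by
  have hsq : Real.sqrt (4 / 5 * (49 / 20)) = 7 / 5 := by
    rw [show (4 / 5 * (49 / 20) : ℝ) = (7 / 5) ^ 2 by norm_num, Real.sqrt_sq (by norm_num)]
  have hmod : OneLinkKRModulus 3 (11 / 30) (7 / 5) := by
    have h := oneLinkKRModulus_of_poincare_of_varianceBound (N := 3) (by norm_num) (by norm_num)
      (hP.mono (by norm_num) le_rfl) hV
    rwa [hsq] at h
  have habs : |βW / 3| / ((3 : ℕ) : ℝ) = |βW| / 9 := by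
    rw [Nat.cast_ofNat, abs_div, abs_of_pos (by norm_num : (0 : ℝ) < 3)]; ring
  have hR' : |βW / 3| / ((3 : ℕ) : ℝ) * (2 * ((d : ℝ) - 1)) ≤ 11 / 30 := by
    rw [habs]; nlinarith [abs_nonneg βW]
  have h3 : Real.sqrt ((3 : ℕ) : ℝ) = Real.sqrt 3 := by rw [Nat.cast_ofNat]
  have hc' : c = 7 / 5 * exp (2 * ((d : ℝ) - 1) * a₀) * (1 + 2 * Real.sqrt ((3 : ℕ) : ℝ) * (2 * ((d : ℝ) - 1) * lam)) *
      (|βW / 3| / ((3 : ℕ) : ℝ)) + Real.sqrt ((3 : ℕ) : ℝ) * lam := by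
    rw [h3, habs]; exact hc
  have h := clustersWith_plaquetteAction (d := d) (L := L) (N := 3) hd (by norm_num) hL (by norm_num) hlam hR' hmod hfc hfconj
    hfinv hfosc hflip hW hc' hcd
  rw [h3] at h
  exact h

/-! ### 2. `d = 4` and `d = 3` row schemas in the density-ball convention `a₀ = 2η`, `λ = η` -/

/-- `√3 ≤ 1.7321`. [folklore] -/
theorem sqrt_three_le_17321 : Real.sqrt 3 ≤ 1.7321 := by
  rw [show (1.7321 : ℝ) = Real.sqrt (1.7321 ^ 2) by rw [Real.sqrt_sq (by norm_num)]]
  exact Real.sqrt_le_sqrt (by norm_num)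

/-- The effective coefficient under the majorants: for `0 ≤ η`, `kη ≤ 1` (`k = 4(d−1)`), `0 ≤ β_W`,
`(7/5)e^{kη}(1 + 2√3(k/2)η)(β_W/9) + √3η ≤ (7/5)T(kη)(1 + 1.7321kη)(β_W/9) + 1.7321η`. [folklore] -/
theorem ceff_le_majorant {k βW η : ℝ} (hk : 0 ≤ k) (hη : 0 ≤ η) (hkη : k * η ≤ 1) (hβ : 0 ≤ βW) :
    7 / 5 * exp (k * η) * (1 + 2 * Real.sqrt 3 * (k / 2 * η)) * (βW / 9) + Real.sqrt 3 * η ≤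
      7 / 5 * (1 + k * η + (k * η) ^ 2 / 2 + (k * η) ^ 3 / 6 + 5 / 96 * (k * η) ^ 4) * (1 + 1.7321 * k * η) * (βW / 9) +
        1.7321 * η := by
  have hE := exp_le_taylor4 (x := k * η) (by positivity) hkη
  have hs := sqrt_three_le_17321
  have hs0 : 0 ≤ Real.sqrt 3 := Real.sqrt_nonneg _
  have hkη0 : 0 ≤ k * η := by positivity
  have h1 : 1 + 2 * Real.sqrt 3 * (k / 2 * η) ≤ 1 + 1.7321 * k * η := by nlinarith
  have h10 : 0 ≤ 1 + 2 * Real.sqrt 3 * (k / 2 * η) := by positivity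
  have h2 : exp (k * η) * (1 + 2 * Real.sqrt 3 * (k / 2 * η)) ≤
      (1 + k * η + (k * η) ^ 2 / 2 + (k * η) ^ 3 / 6 + 5 / 96 * (k * η) ^ 4) * (1 + 1.7321 * k * η) :=
    mul_le_mul hE h1 h10 ((exp_pos _).le.trans hE)
  have h3 : Real.sqrt 3 * η ≤ 1.7321 * η := mul_le_mul_of_nonneg_right hs hη
  nlinarith [mul_le_mul_of_nonneg_right h2 (by positivity : (0 : ℝ) ≤ βW / 9)]

/-- **`SU(3)`, `d = 4`, plaquette-rung row schema** (density ball `osc f ≤ 2η`, `Lip f ≤ η`): `0 ≤ β_W ≤ 11/20`, `0 ≤ η ≤ 1/12` and the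
RATIONAL certificate `12c'² + 10c' < 1` at `c' = (7/5)T(12η)(1 + 1.7321·12η)(β_W/9) + 1.7321η` give, GIVEN H1, H2, for every torus `L ≥ 3`
and every plaquette-local member with density `f`: `ClustersWith W (β_W/3) A m` with ds-4's explicit `(A, m)` at the exact `c_eff`. [folklore] -/
theorem su3_plaquetteRung4 (hL : 3 ≤ L) (hP : OneLinkPoincareSUN 3 (3 / 5) (4 / 5)) (hV : OneLinkVarianceBound 3 (11 / 30) (49 / 20))
    {βW η : ℝ} (hβ0 : 0 ≤ βW) (hβ : βW ≤ 11 / 20) (hη0 : 0 ≤ η) (hη1 : η ≤ 1 / 12)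
    (hcert : 12 * (7 / 5 * (1 + 12 * η + (12 * η) ^ 2 / 2 + (12 * η) ^ 3 / 6 + 5 / 96 * (12 * η) ^ 4) * (1 + 1.7321 * 12 * η) *
        (βW / 9) + 1.7321 * η) ^ 2 +
      10 * (7 / 5 * (1 + 12 * η + (12 * η) ^ 2 / 2 + (12 * η) ^ 3 / 6 + 5 / 96 * (12 * η) ^ 4) * (1 + 1.7321 * 12 * η) *
        (βW / 9) + 1.7321 * η) < 1)
    {f : SUN 3 → ℝ} (hfc : Continuous f) (hfconj : ∀ g h : SUN 3, f (g * h * g⁻¹) = f h) (hfinv : ∀ h : SUN 3, f h⁻¹ = f h)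
    (hfosc : ∀ x y, f x - f y ≤ 2 * η) (hflip : ∀ x y, |f x - f y| ≤ η * suFrobDist x y)
    {W : Perturbation 4 L 3} (hW : IsPlaquetteAction f W) :
    let c : ℝ := 7 / 5 * exp (2 * (((4 : ℕ) : ℝ) - 1) * (2 * η)) * (1 + 2 * Real.sqrt 3 * (2 * (((4 : ℕ) : ℝ) - 1) * η)) *
      (|βW| / 9) + Real.sqrt 3 * η
    ClustersWith W (βW / 3)
      (4 * (2 * Real.sqrt 3) ^ 2 * exp (2 * ((1 - gaugeR 4 c) ^ 2 / (2 * (2 * gaugeR 4 c * (2 * 4 : ℕ) + 1)))))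
      ((1 - gaugeR 4 c) ^ 2 / (2 * (2 * gaugeR 4 c * (2 * 4 : ℕ) + 1))) := by
  intro c
  have hc0 : 0 ≤ c := by positivity
  refine su3_clustersWith_plaquetteAction (d := 4) (by norm_num) hL hP hV hη0 (by rw [abs_of_nonneg hβ0]; push_cast; linarith)
    hfc hfconj hfinv hfosc hflip hW rfl ?_
  -- door: `doorPoly 4 c ≤ doorPoly 4 c' < 1`
  have hce : c = 7 / 5 * exp (12 * η) * (1 + 2 * Real.sqrt 3 * (12 / 2 * η)) * (βW / 9) + Real.sqrt 3 * η := by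
    show 7 / 5 * exp (2 * (((4 : ℕ) : ℝ) - 1) * (2 * η)) * (1 + 2 * Real.sqrt 3 * (2 * (((4 : ℕ) : ℝ) - 1) * η)) *
      (|βW| / 9) + Real.sqrt 3 * η = _
    rw [abs_of_nonneg hβ0]; push_cast; ring_nf
  have hmaj := ceff_le_majorant (k := 12) (by norm_num) hη0 (by linarith) hβ0
  rw [← hce] at hmaj
  refine lt_of_le_of_lt (doorPoly_mono (d := 4) (by norm_num) hc0 hmaj) ?_
  unfold doorPoly
  push_cast
  nlinarith [hcert]

/-- **`SU(3)`, `d = 3`, plaquette-rung row schema**: `0 ≤ β_W ≤ 33/40`, `0 ≤ η ≤ 1/8`, certificate `8c'² + 6c' < 1` at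
`c' = (7/5)T(8η)(1 + 1.7321·8η)(β_W/9) + 1.7321η` ⇒ `ClustersWith W (β_W/3) A m` for plaquette-local members on tori `L ≥ 3`, GIVEN H1, H2. [folklore] -/
theorem su3_plaquetteRung3 (hL : 3 ≤ L) (hP : OneLinkPoincareSUN 3 (3 / 5) (4 / 5)) (hV : OneLinkVarianceBound 3 (11 / 30) (49 / 20))
    {βW η : ℝ} (hβ0 : 0 ≤ βW) (hβ : βW ≤ 33 / 40) (hη0 : 0 ≤ η) (hη1 : η ≤ 1 / 8)
    (hcert : 8 * (7 / 5 * (1 + 8 * η + (8 * η) ^ 2 / 2 + (8 * η) ^ 3 / 6 + 5 / 96 * (8 * η) ^ 4) * (1 + 1.7321 * 8 * η) *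
        (βW / 9) + 1.7321 * η) ^ 2 +
      6 * (7 / 5 * (1 + 8 * η + (8 * η) ^ 2 / 2 + (8 * η) ^ 3 / 6 + 5 / 96 * (8 * η) ^ 4) * (1 + 1.7321 * 8 * η) *
        (βW / 9) + 1.7321 * η) < 1)
    {f : SUN 3 → ℝ} (hfc : Continuous f) (hfconj : ∀ g h : SUN 3, f (g * h * g⁻¹) = f h) (hfinv : ∀ h : SUN 3, f h⁻¹ = f h)
    (hfosc : ∀ x y, f x - f y ≤ 2 * η) (hflip : ∀ x y, |f x - f y| ≤ η * suFrobDist x y)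
    {W : Perturbation 3 L 3} (hW : IsPlaquetteAction f W) :
    let c : ℝ := 7 / 5 * exp (2 * (((3 : ℕ) : ℝ) - 1) * (2 * η)) * (1 + 2 * Real.sqrt 3 * (2 * (((3 : ℕ) : ℝ) - 1) * η)) *
      (|βW| / 9) + Real.sqrt 3 * η
    ClustersWith W (βW / 3)
      (4 * (2 * Real.sqrt 3) ^ 2 * exp (2 * ((1 - gaugeR 3 c) ^ 2 / (2 * (2 * gaugeR 3 c * (2 * 3 : ℕ) + 1)))))
      ((1 - gaugeR 3 c) ^ 2 / (2 * (2 * gaugeR 3 c * (2 * 3 : ℕ) + 1))) := by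
  intro c
  have hc0 : 0 ≤ c := by positivity
  refine su3_clustersWith_plaquetteAction (d := 3) (by norm_num) hL hP hV hη0 (by rw [abs_of_nonneg hβ0]; push_cast; linarith)
    hfc hfconj hfinv hfosc hflip hW rfl ?_
  have hce : c = 7 / 5 * exp (8 * η) * (1 + 2 * Real.sqrt 3 * (8 / 2 * η)) * (βW / 9) + Real.sqrt 3 * η := by
    show 7 / 5 * exp (2 * (((3 : ℕ) : ℝ) - 1) * (2 * η)) * (1 + 2 * Real.sqrt 3 * (2 * (((3 : ℕ) : ℝ) - 1) * η)) *
      (|βW| / 9) + Real.sqrt 3 * η = _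
    rw [abs_of_nonneg hβ0]; push_cast; ring_nf
  have hmaj := ceff_le_majorant (k := 8) (by norm_num) hη0 (by linarith) hβ0
  rw [← hce] at hmaj
  refine lt_of_le_of_lt (doorPoly_mono (d := 3) (by norm_num) hc0 hmaj) ?_
  unfold doorPoly
  push_cast
  nlinarith [hcert]

/-! ### 3. Rows of record (`d = 4`: `(β⋆_W, η) = (1/4, .015) (1/3, .010) (2/5, .007) (9/20, .004) (1/2, .002)`; `d = 3`: `(1/2, .017) (3/5, .011) (3/4, .005)`) -/

/-- `d = 4` plaquette-rung row `(β⋆_W, η) = (1/4, 0.015)` on H1, H2: every plaquette-local member with a continuous inversion-invariant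
class-function density of oscillation `≤ 0.030` and Lipschitz constant `≤ 0.015` clusters on every torus `L ≥ 3` at `β_W = 1/4`. [folklore] -/
theorem su3_plaquetteRung4_1_4 (hL : 3 ≤ L) (hP : OneLinkPoincareSUN 3 (3 / 5) (4 / 5))
    (hV : OneLinkVarianceBound 3 (11 / 30) (49 / 20)) {f : SUN 3 → ℝ} (hfc : Continuous f)
    (hfconj : ∀ g h : SUN 3, f (g * h * g⁻¹) = f h) (hfinv : ∀ h : SUN 3, f h⁻¹ = f h)
    (hfosc : ∀ x y, f x - f y ≤ 2 * (15 / 1000)) (hflip : ∀ x y, |f x - f y| ≤ 15 / 1000 * suFrobDist x y)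
    {W : Perturbation 4 L 3} (hW : IsPlaquetteAction f W) :
    let c : ℝ := 7 / 5 * exp (2 * (((4 : ℕ) : ℝ) - 1) * (2 * (15 / 1000))) *
      (1 + 2 * Real.sqrt 3 * (2 * (((4 : ℕ) : ℝ) - 1) * (15 / 1000))) * (|(1 / 4 : ℝ)| / 9) + Real.sqrt 3 * (15 / 1000)
    ClustersWith W ((1 / 4 : ℝ) / 3)
      (4 * (2 * Real.sqrt 3) ^ 2 * exp (2 * ((1 - gaugeR 4 c) ^ 2 / (2 * (2 * gaugeR 4 c * (2 * 4 : ℕ) + 1)))))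
      ((1 - gaugeR 4 c) ^ 2 / (2 * (2 * gaugeR 4 c * (2 * 4 : ℕ) + 1))) :=
  su3_plaquetteRung4 hL hP hV (by norm_num) (by norm_num) (by norm_num) (by norm_num) (by norm_num) hfc hfconj hfinv hfosc hflip hW

/-- `d = 4` plaquette-rung row `(1/3, 0.010)` on H1, H2. [folklore] -/
theorem su3_plaquetteRung4_1_3 (hL : 3 ≤ L) (hP : OneLinkPoincareSUN 3 (3 / 5) (4 / 5))
    (hV : OneLinkVarianceBound 3 (11 / 30) (49 / 20)) {f : SUN 3 → ℝ} (hfc : Continuous f)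
    (hfconj : ∀ g h : SUN 3, f (g * h * g⁻¹) = f h) (hfinv : ∀ h : SUN 3, f h⁻¹ = f h)
    (hfosc : ∀ x y, f x - f y ≤ 2 * (1 / 100)) (hflip : ∀ x y, |f x - f y| ≤ 1 / 100 * suFrobDist x y)
    {W : Perturbation 4 L 3} (hW : IsPlaquetteAction f W) :
    let c : ℝ := 7 / 5 * exp (2 * (((4 : ℕ) : ℝ) - 1) * (2 * (1 / 100))) *
      (1 + 2 * Real.sqrt 3 * (2 * (((4 : ℕ) : ℝ) - 1) * (1 / 100))) * (|(1 / 3 : ℝ)| / 9) + Real.sqrt 3 * (1 / 100)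
    ClustersWith W ((1 / 3 : ℝ) / 3)
      (4 * (2 * Real.sqrt 3) ^ 2 * exp (2 * ((1 - gaugeR 4 c) ^ 2 / (2 * (2 * gaugeR 4 c * (2 * 4 : ℕ) + 1)))))
      ((1 - gaugeR 4 c) ^ 2 / (2 * (2 * gaugeR 4 c * (2 * 4 : ℕ) + 1))) :=
  su3_plaquetteRung4 hL hP hV (by norm_num) (by norm_num) (by norm_num) (by norm_num) (by norm_num) hfc hfconj hfinv hfosc hflip hW

/-- `d = 4` plaquette-rung row `(9/20, 0.004)` on H1, H2 — beyond the pair door's `5/14` and the `SU(2)` star door's `9/25`. [folklore] -/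
theorem su3_plaquetteRung4_9_20 (hL : 3 ≤ L) (hP : OneLinkPoincareSUN 3 (3 / 5) (4 / 5))
    (hV : OneLinkVarianceBound 3 (11 / 30) (49 / 20)) {f : SUN 3 → ℝ} (hfc : Continuous f)
    (hfconj : ∀ g h : SUN 3, f (g * h * g⁻¹) = f h) (hfinv : ∀ h : SUN 3, f h⁻¹ = f h)
    (hfosc : ∀ x y, f x - f y ≤ 2 * (4 / 1000)) (hflip : ∀ x y, |f x - f y| ≤ 4 / 1000 * suFrobDist x y)
    {W : Perturbation 4 L 3} (hW : IsPlaquetteAction f W) :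
    let c : ℝ := 7 / 5 * exp (2 * (((4 : ℕ) : ℝ) - 1) * (2 * (4 / 1000))) *
      (1 + 2 * Real.sqrt 3 * (2 * (((4 : ℕ) : ℝ) - 1) * (4 / 1000))) * (|(9 / 20 : ℝ)| / 9) + Real.sqrt 3 * (4 / 1000)
    ClustersWith W ((9 / 20 : ℝ) / 3)
      (4 * (2 * Real.sqrt 3) ^ 2 * exp (2 * ((1 - gaugeR 4 c) ^ 2 / (2 * (2 * gaugeR 4 c * (2 * 4 : ℕ) + 1)))))
      ((1 - gaugeR 4 c) ^ 2 / (2 * (2 * gaugeR 4 c * (2 * 4 : ℕ) + 1))) :=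
  su3_plaquetteRung4 hL hP hV (by norm_num) (by norm_num) (by norm_num) (by norm_num) (by norm_num) hfc hfconj hfinv hfosc hflip hW

/-- `d = 4` plaquette-rung row `(1/2, 0.002)` on H1, H2. [folklore] -/
theorem su3_plaquetteRung4_1_2 (hL : 3 ≤ L) (hP : OneLinkPoincareSUN 3 (3 / 5) (4 / 5))
    (hV : OneLinkVarianceBound 3 (11 / 30) (49 / 20)) {f : SUN 3 → ℝ} (hfc : Continuous f)
    (hfconj : ∀ g h : SUN 3, f (g * h * g⁻¹) = f h) (hfinv : ∀ h : SUN 3, f h⁻¹ = f h)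
    (hfosc : ∀ x y, f x - f y ≤ 2 * (2 / 1000)) (hflip : ∀ x y, |f x - f y| ≤ 2 / 1000 * suFrobDist x y)
    {W : Perturbation 4 L 3} (hW : IsPlaquetteAction f W) :
    let c : ℝ := 7 / 5 * exp (2 * (((4 : ℕ) : ℝ) - 1) * (2 * (2 / 1000))) *
      (1 + 2 * Real.sqrt 3 * (2 * (((4 : ℕ) : ℝ) - 1) * (2 / 1000))) * (|(1 / 2 : ℝ)| / 9) + Real.sqrt 3 * (2 / 1000)
    ClustersWith W ((1 / 2 : ℝ) / 3)
      (4 * (2 * Real.sqrt 3) ^ 2 * exp (2 * ((1 - gaugeR 4 c) ^ 2 / (2 * (2 * gaugeR 4 c * (2 * 4 : ℕ) + 1)))))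
      ((1 - gaugeR 4 c) ^ 2 / (2 * (2 * gaugeR 4 c * (2 * 4 : ℕ) + 1))) :=
  su3_plaquetteRung4 hL hP hV (by norm_num) (by norm_num) (by norm_num) (by norm_num) (by norm_num) hfc hfconj hfinv hfosc hflip hW

/-- `d = 3` plaquette-rung row `(1/2, 0.017)` on H1, H2. [folklore] -/
theorem su3_plaquetteRung3_1_2 (hL : 3 ≤ L) (hP : OneLinkPoincareSUN 3 (3 / 5) (4 / 5))
    (hV : OneLinkVarianceBound 3 (11 / 30) (49 / 20)) {f : SUN 3 → ℝ} (hfc : Continuous f)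
    (hfconj : ∀ g h : SUN 3, f (g * h * g⁻¹) = f h) (hfinv : ∀ h : SUN 3, f h⁻¹ = f h)
    (hfosc : ∀ x y, f x - f y ≤ 2 * (17 / 1000)) (hflip : ∀ x y, |f x - f y| ≤ 17 / 1000 * suFrobDist x y)
    {W : Perturbation 3 L 3} (hW : IsPlaquetteAction f W) :
    let c : ℝ := 7 / 5 * exp (2 * (((3 : ℕ) : ℝ) - 1) * (2 * (17 / 1000))) *
      (1 + 2 * Real.sqrt 3 * (2 * (((3 : ℕ) : ℝ) - 1) * (17 / 1000))) * (|(1 / 2 : ℝ)| / 9) + Real.sqrt 3 * (17 / 1000)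
    ClustersWith W ((1 / 2 : ℝ) / 3)
      (4 * (2 * Real.sqrt 3) ^ 2 * exp (2 * ((1 - gaugeR 3 c) ^ 2 / (2 * (2 * gaugeR 3 c * (2 * 3 : ℕ) + 1)))))
      ((1 - gaugeR 3 c) ^ 2 / (2 * (2 * gaugeR 3 c * (2 * 3 : ℕ) + 1))) :=
  su3_plaquetteRung3 hL hP hV (by norm_num) (by norm_num) (by norm_num) (by norm_num) (by norm_num) hfc hfconj hfinv hfosc hflip hW

/-- `d = 3` plaquette-rung row `(3/4, 0.005)` on H1, H2. [folklore] -/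
theorem su3_plaquetteRung3_3_4 (hL : 3 ≤ L) (hP : OneLinkPoincareSUN 3 (3 / 5) (4 / 5))
    (hV : OneLinkVarianceBound 3 (11 / 30) (49 / 20)) {f : SUN 3 → ℝ} (hfc : Continuous f)
    (hfconj : ∀ g h : SUN 3, f (g * h * g⁻¹) = f h) (hfinv : ∀ h : SUN 3, f h⁻¹ = f h)
    (hfosc : ∀ x y, f x - f y ≤ 2 * (5 / 1000)) (hflip : ∀ x y, |f x - f y| ≤ 5 / 1000 * suFrobDist x y)
    {W : Perturbation 3 L 3} (hW : IsPlaquetteAction f W) :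
    let c : ℝ := 7 / 5 * exp (2 * (((3 : ℕ) : ℝ) - 1) * (2 * (5 / 1000))) *
      (1 + 2 * Real.sqrt 3 * (2 * (((3 : ℕ) : ℝ) - 1) * (5 / 1000))) * (|(3 / 4 : ℝ)| / 9) + Real.sqrt 3 * (5 / 1000)
    ClustersWith W ((3 / 4 : ℝ) / 3)
      (4 * (2 * Real.sqrt 3) ^ 2 * exp (2 * ((1 - gaugeR 3 c) ^ 2 / (2 * (2 * gaugeR 3 c * (2 * 3 : ℕ) + 1)))))
      ((1 - gaugeR 3 c) ^ 2 / (2 * (2 * gaugeR 3 c * (2 * 3 : ℕ) + 1))) :=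
  su3_plaquetteRung3 hL hP hV (by norm_num) (by norm_num) (by norm_num) (by norm_num) (by norm_num) hfc hfconj hfinv hfosc hflip hW

/-- Numbers: the star door's thresholds `c⋆(4) ∈ (0.0902, 0.0903)` (`12c² + 10c = 1`), `c⋆(3) ∈ (0.1403, 0.1404)`; the Wilson parts
`(7/45)β_W` at `β_W = 11/20` (`0.0856 < c⋆(4)`, radius-capped) and `(28/135)(33/40)` (`0.1711 > c⋆(3)`: at `d = 3` the door closes first, at
`β_W = 0.676…`). [folklore] -/
theorem su3_plaquetteRung_numbers :
    (12 : ℝ) * 0.0902 ^ 2 + 10 * 0.0902 < 1 ∧ (1 : ℝ) < 12 * 0.0903 ^ 2 + 10 * 0.0903 ∧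
      (8 : ℝ) * 0.1403 ^ 2 + 6 * 0.1403 < 1 ∧ (1 : ℝ) < 8 * 0.1404 ^ 2 + 6 * 0.1404 ∧
      (7 / 45 : ℝ) * (11 / 20) < 0.0902 ∧ (28 / 135 : ℝ) * (33 / 40) > 0.1404 := by
  norm_num

end Summit.Ventures.YMGap.RobustBallSU3

end
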